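import Mathlib
import HarnessLib
import Summits.CriticalPhenomena.CardyFormulaZ2.Theses.CardySelfRefinement
import Literature.Probability.RandomPlanarGeometry.ChordalReversibility
import Literature.Probability.RandomPlanarGeometry.ConformalRectangle
import Literature.Probability.RandomPlanarGeometry.IsometryCovariance
import Literature.Probability.Percolation.IkhlefPonsaingFirstPassage
import Summits.CriticalPhenomena.CardyFormulaZ2.Theorems.CardySelfRefinementLagHandOffDiscretisable
import Summits.CriticalPhenomena.CardyFormulaZ2.Theorems.CardySelfRefinementSymmetryUpgradeRTouchExponentOfLatticeBounds
import Summits.CriticalPhenomena.CardyFormulaZ2.Theorems.CardySelfRefinementSymmetryUpgradeRTouchTriangleDomain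
import Summits.CriticalPhenomena.CardyFormulaZ2.Theorems.CardySelfRefinementSymmetryUpgradeRTouchUpperLattice
import Summits.CriticalPhenomena.CardyFormulaZ2.Theorems.CardyBoundaryCoulombGasHalfPlaneOneArmThirdRotationTransfer

/-!
# `stub_touchExponent` from Ikhlef–Ponsaing's Prop. 4.7 and ONE lattice lower bound (assembly)

Helper file for stub `stub_touchExponent` (S3) of line `SketchIdeatorTwo` of crux `SymmetryUpgradeR`
(stmt-CriticalPhenomena-17239, route CardySelfRefinement), stage T5 (assembly).

`touchExponent_of_lowerLatticeBound`: the registered stub `stub_touchExponent` — two-sided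
`ε^{1/3}` bounds for the touch probability of the clause-(iv) scaling limit `P` at a locally flat
point of the free arc of some Dobrushin domain — follows VERBATIM from

* the named fact `Literature.Probability.Percolation.IkhlefPonsaingFirstPassage` (Ikhlef–Ponsaing
  2012, Prop. 4.7; UNPROVED tree fact, hypothesis), and
* ONE lattice statement taken here as the explicit hypothesis `hlow` and NOT proved anywhere yet:
  the LOWER lattice touch bound `c ε^{1/3} ≤ P_{1/2}[bond interface of (Δ, E δ) within ε of z]`
  for the triangle domain `Δ` of `touchExponent_triangleDomain`, every admissible
  `ℤ²`-discretisation family `E` of it, every `ε ∈ (0, ε₀)` and all small meshes `δ`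
  (`z = -(1+i)/2`; the mirror image of the landed upper bound `touchExponent_upperLatticeBound`),

by: the triangle domain and its diagonal flat wall (`touchExponent_triangleDomain`, T4a), an
admissible discretisation family of it (`stub_discretisable`, crux `LagHandOff`), the upper bound
(`touchExponent_upperLatticeBound`, T4b, conditional on the fact), and the portmanteau transfer of
mesh-uniform two-sided lattice bounds to the limit family along clause (iv)
(`stub_touchExponent_ofLatticeBounds`, wave 1); `‖e^{-iπ/4}‖ = 1` is the tree's `norm_cdiag`.

What `hlow` needs (not in the tree): the discrete "interface = outer boundary of the wired
cluster" dictionary (a `β`-open path from the discrete wired arc to `B(z, ε/2)` forces the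
exploration polygon within `ε` of `z`; planar separation / the interface cycle of
`CornerPermutation.lean`) and Harris–FKG gluing of the two-scale diagonal arm of
`touchExponent_twoScaleArm` (lower half) to the wired axis-parallel leg through fixed-scale RSW
crossings inside `Δ`.
-/

noncomputable section

namespace Summit.CriticalPhenomena.CardyFormulaZ2.Theorems.SymmetryUpgradeR.SwallowingSkeleton

open MeasureTheory Filter Set
open Literature.Probability.RandomPlanarGeometry Literature.Probability.LatticeModels
  Literature.Probability.Percolation
open UpperHalfPlane (upperHalfPlaneSet)
open Summit.CriticalPhenomena.CardyFormulaZ2.Cruxes.LagHandOff.HittingTournament (stub_discretisable)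

/-- **T5 `touchExponent_of_lowerLatticeBound`** (registered helper for `stub_touchExponent`):
the stub VERBATIM from Ikhlef–Ponsaing's Prop. 4.7 and the lower lattice touch bound at the
diagonal wall of the triangle domain (explicit hypothesis; see the module docstring). -/
theorem touchExponent_of_lowerLatticeBound : Literature.Probability.Percolation.IkhlefPonsaingFirstPassage → (∀ (D : DobrushinDomain) (E : ℝ → DiscreteDobrushin), D.carrier = {w : ℂ | w.re < 0 ∧ w.im < 0 ∧ -1 < w.re + w.im} → D.pt 0 = -1 → D.pt 1 = -Complex.I → D.arc 0 = segment ℝ (-1 : ℂ) 0 ∪ segment ℝ (0 : ℂ) (-Complex.I) → D.arc 1 = segment ℝ (-Complex.I) (-1 : ℂ) → ZdDiscretisationFamily D E → ∃ c ε₀ : ℝ, 0 < c ∧ 0 < ε₀ ∧ ∀ ε ∈ Set.Ioo 0 ε₀, ∀ᶠ δ in nhdsWithin (0 : ℝ) (Set.Ioi 0), c * ε ^ (1 / 3 : ℝ) ≤ (bondPercolation (zdGraph 2) half).real {ω | ∃ w ∈ (bondInterfaceIn D (E δ) ω).range, dist w (-(1 + Complex.I) / 2) < ε}) → ∀ P :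 ChordalFamily, IsLocalMarkovChordalFamily P → (∀ D : DobrushinDomain, ∀ᵐ γ ∂(P D), ∀ c : Curve ℂ, CurveClass.mk c = γ → ∀ s t : unitInterval, s < t → c '' Set.Icc s t ⊆ frontier D.carrier → (c '' Set.Icc s t).Subsingleton) → ((∀ (D : DobrushinDomain) (E : ℝ → DiscreteDobrushin), ZdDiscretisationFamily D E → ∀ᶠ δ in nhdsWithin (0 : ℝ) (Set.Ioi 0), AEMeasurable (bondInterfaceIn D (E δ)) (bondPercolation (zdGraph 2) half)) ∧ ∃ δs : ℕ → ℝ, (∀ n, 0 < δs n) ∧ Tendsto δs atTop (nhds 0) ∧ ∀ (D : DobrushinDomain) (E : ℝ → DiscreteDobrushin), ZdDiscretisationFamily D E → ∀ f : BoundedContinuousFunction (CurveClass ℂ) ℝ, Tendsto (fun n => ∫ ω, f (bondInterfaceIn D (E (δs n)) ω) ∂(bondPercolation (zdGraph 2) half)) atTop (nhds (∫ γ, f γ ∂(P D)))) → (∃ (D : DobrushinDomain) (z u : ℂ) (r : ℝ), z ∈ D.arc 1 ∧ z ≠ D.pt 0 ∧ z ≠ D.pt 1 ∧ ‖u‖ =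 1 ∧ 0 < r ∧ D.carrier ∩ Metric.ball z r = {w | w ∈ Metric.ball z r ∧ 0 < ((starRingEnd ℂ) u * (w - z)).im} ∧ ∃ c C ε₀ : ℝ, 0 < c ∧ 0 < ε₀ ∧ ∀ ε ∈ Set.Ioo 0 ε₀, c * ε ^ (1 / 3 : ℝ) ≤ (P D).real {γ | ∃ w ∈ γ.range, dist w z < ε} ∧ (P D).real {γ | ∃ w ∈ γ.range, dist w z < ε} ≤ C * ε ^ (1 / 3 : ℝ)) := by
  intro hIP hlow P hP _ hIV
  obtain ⟨D, hcar, hp0, hp1, hA0, hA1, hwall⟩ := touchExponent_triangleDomain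
  obtain ⟨E, hE⟩ := stub_discretisable D
  obtain ⟨C, ε₁, hε₁, hup⟩ := touchExponent_upperLatticeBound hIP D E hcar hp0 hp1 hA0 hA1 hE
  obtain ⟨c, ε₂, hc, hε₂, hlo⟩ := hlow D E hcar hp0 hp1 hA0 hA1 hE
  set z : ℂ := -(1 + Complex.I) / 2 with hz
  have hlatt : ∀ ε ∈ Set.Ioo 0 (min ε₁ ε₂), ∀ᶠ δ in nhdsWithin (0 : ℝ) (Set.Ioi 0),
      c * ε ^ (1 / 3 : ℝ) ≤ (bondPercolation (zdGraph 2) half).real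
        {ω | ∃ w ∈ (bondInterfaceIn D (E δ) ω).range, dist w z < ε} ∧
      (bondPercolation (zdGraph 2) half).real
        {ω | ∃ w ∈ (bondInterfaceIn D (E δ) ω).range, dist w z < ε} ≤ C * ε ^ (1 / 3 : ℝ) := by
    intro ε hε
    exact (hlo ε ⟨hε.1, hε.2.trans_le (min_le_right _ _)⟩).and
      (hup ε ⟨hε.1, hε.2.trans_le (min_le_left _ _)⟩)
  have key := stub_touchExponent_ofLatticeBounds P hP hIV D E hE z (1 / 3) c C (min ε₁ ε₂) hlatt
  have hzre : z.re = -(1 / 2) := by norm_num [hz]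
  have hzim : z.im = -(1 / 2) := by norm_num [hz]
  refine ⟨D, z, ⟨Real.sqrt 2 / 2, -(Real.sqrt 2 / 2)⟩, 1 / 4, ?_, ?_, ?_,
    Summit.CriticalPhenomena.CardyFormulaZ2.Cruxes.HalfPlaneOneArmThird.IpPassageStirling.norm_cdiag,
    by norm_num, hwall, c, C, min ε₁ ε₂, hc, lt_min hε₁ hε₂, key⟩
  · rw [hA1]
    exact ⟨1 / 2, 1 / 2, by norm_num, by norm_num, by norm_num, by rw [hz]; simp; ring⟩
  · rw [hp0]
    intro h
    have := congrArg Complex.im h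
    rw [hzim] at this
    norm_num at this
  · rw [hp1]
    intro h
    have := congrArg Complex.re h
    rw [hzre] at this
    norm_num at this


/-! ### The lower lattice bound from the dictionary and the wired-arm estimate -/

/-- **T6 `touchExponent_lowerLatticeBound_of`** (registered helper for `stub_touchExponent`):
the shape of the missing lower bound, for a discretisation family `E` of a Dobrushin domain `D`
and a point `z`. If (i) DICTIONARY (for the admissible data of the family): a path of the
completed configuration `bcBondConfig ω` from a site of the discrete wired arc `A` to a site `v`
forces the exploration polygon to pass between `v` and every site `w` of the discrete free arc
`B`, within `dist(δv, δw) + 4δ` of `δv` — the discrete "interface = outer boundary of the wired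
cluster" / separation statement — and (ii) WIRED ARM: with probability `≥ c ε^{1/3}`, eventually
in the mesh, some wired-arc site is joined by `bcBondConfig ω` to a site within `ε/4` of `z` while
some free-arc site lies within `ε/4` of `z`, then the lattice touch probability at `z` is
`≥ c ε^{1/3}` eventually in the mesh (the polygon passes within `3ε/4 + 4δ < ε` of `z`). -/
theorem touchExponent_lowerLatticeBound_of : ∀ (D : DobrushinDomain) (E : ℝ → DiscreteDobrushin) (z : ℂ) (c ε₀ : ℝ), ZdDiscretisationFamily D E → 0 < ε₀ → (∀ δ : ℝ, (E δ).IsZdAdmissible → ∀ (ω : BondConfig (Site 2)) (u v w : Site 2), u ∈ (E δ).zdArcA → w ∈ (E δ).zdArcB → (E δ).bcBondConfig ω ∈ openConnIn Set.univ u v → ∃ t : unitInterval, dist (medialExplorationCurve (E δ) ω t) (meshPoint (E δ).δ v) ≤ dist (meshPoint (E δ).δ v) (meshPoint (E δ).δ w) + 4 * (E δ).δ) → (∀ ε ∈ Set.Ioo 0 ε₀, ∀ᶠ δ in nhdsWithin (0 : ℝ) (Set.Ioi 0), c * ε ^ (1 / 3 : ℝ) ≤ (bondPercolation (zdGraph 2)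 half).real {ω | ∃ u ∈ (E δ).zdArcA, ∃ v : Site 2, ∃ w ∈ (E δ).zdArcB, dist (meshPoint δ v) z ≤ ε / 4 ∧ dist (meshPoint δ w) z ≤ ε / 4 ∧ (E δ).bcBondConfig ω ∈ openConnIn Set.univ u v}) → ∀ ε ∈ Set.Ioo 0 ε₀, ∀ᶠ δ in nhdsWithin (0 : ℝ) (Set.Ioi 0), c * ε ^ (1 / 3 : ℝ) ≤ (bondPercolation (zdGraph 2) half).real {ω | ∃ w ∈ (bondInterfaceIn D (E δ) ω).range, dist w z < ε} := by
  intro D E z c ε₀ hE _ hdict hL2 ε hε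
  have hδε : ∀ᶠ δ in nhdsWithin (0 : ℝ) (Set.Ioi 0), δ < ε / 16 :=
    mem_nhdsWithin_of_mem_nhds (Iio_mem_nhds (by linarith [hε.1]))
  filter_upwards [hL2 ε hε, hE.eventually_isZdAdmissible, hδε] with δ hlow hadm hδ
  refine hlow.trans (measureReal_mono (fun ω hω => ?_) (measure_ne_top _ _))
  obtain ⟨u, hu, v, w, hw, hv, hwz, hconn⟩ := hω
  obtain ⟨t, ht⟩ := hdict δ hadm ω u v w hu hw hconn
  rw [hE.δ_eq δ] at ht
  refine ⟨medialExplorationCurve (E δ) ω t, ?_, ?_⟩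
  · rw [range_bondInterfaceIn]; exact Set.mem_range_self t
  · have h1 := dist_triangle (medialExplorationCurve (E δ) ω t) (meshPoint δ v) z
    have h2 := dist_triangle (meshPoint δ v) z (meshPoint δ w)
    rw [dist_comm z (meshPoint δ w)] at h2
    linarith

end Summit.CriticalPhenomena.CardyFormulaZ2.Theorems.SymmetryUpgradeR.SwallowingSkeleton

end
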